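import Summits.CriticalPhenomena.CardyFormulaZ2.Theorems.CardySusyWardParafermionPrecompactFourClassTransferOfEdgePrecompact
import Summits.CriticalPhenomena.CardyFormulaZ2.Theorems.ParafermionPrecompact.Negative.TwoPassages

/-!
# Strategist census certificate — crux stmt-CriticalPhenomena-11293 `CardySusyWard.ParafermionPrecompact`

Wall-breaker seat `planner-cstrat-stmt-CriticalPhenomena-11293-p1-0` (2026-08-17).  Kernel-checked
skeleton of the four lens attempts of `STRATEGY-CENSUS.md` against the LIVE route file (rev 5, the
decl text still has NO `edgeSet` guards).  Everything is glue over LANDED theorems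
(`Negative.*`, p74235 / p76447 / p78066; `FourClassVertexTransfer.repairedAt_of_edgePrecompact`,
p115329) except §4, a new elementary pigeonhole lemma (what ANY refutation line must deliver).

* §0 `typed_iff_not_H` — the typed decl is `¬H`, `H = ParafermionBulkNondegenerate` (open, DCS 8.7).
* §1 TRANSFER  `line_decides_notH` — a stub set `S` concludes the typed decl iff it proves `S → ¬H`.
* §2 STRENGTHEN `strengthening_false_of_H`, and the natural `S⁺` (a bound at ANY exponent `t > 1/3`,
  even edge-guarded) gives the typed decl (`typed_of_boundAboveThird`), hence is false under `H`.
* §3 DECOMPOSITION `split_child_false_of_H` — every split has a child that is false under `H` given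
  the others; the canonical split `typed ↔ C′ ∧ ¬H` has second child ⇔ parent (`child₂_iff_parent`,
  costume) and first child already reduced to crux 11387 (`child₁_of_edgePrecompact`).
* §4 NEGATION `bulkNondegenerate_of_localisedMass` — `H` follows from a LOCALISED mass lower bound
  `Σ_{z ∈ S_δ} ‖F_δ z‖ ≥ c·δ^{1/3-1}` on `≤ M/δ` medial vertices of a compact `K` (pigeonhole); this
  types the exact deliverable of a diagonal-flux refutation line and isolates its two open inputs
  (sharp half-plane one-arm LOWER bound; sharp near-mark UPPER tail), see the census §Negation.
-/

noncomputable section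

namespace Summit.CriticalPhenomena.CardyFormulaZ2.Cruxes.ParafermionPrecompact.StrategistCensus

open scoped BigOperators Topology
open Filter Set MeasureTheory
open _root_.Literature.Probability.LatticeModels
open _root_.Literature.Probability.RandomPlanarGeometry (DobrushinDomain)
open _root_.Literature.Probability.Percolation (BondConfig bondPercolation half)
open Summit.CriticalPhenomena.CardyFormulaZ2.Theorems.ParafermionPrecompact.Negative
open Summit.CriticalPhenomena.CardyFormulaZ2.Theses.CardyComplexCone (EdgePrecompact)

/-! ## §0 Read-back -/

/-- The typed crux (rev 5, unguarded) is the negation of the open conjecture `H`. [folklore] -/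
theorem typed_iff_not_H :
    Theses.CardySusyWard.ParafermionPrecompact ↔ ¬ ParafermionBulkNondegenerate :=
  parafermionPrecompact_iff_not_bulkNondegenerate

/-! ## §1 Transfer test (applies to every proof line, whatever its language) -/

/-- A stub conjunction `S` reaches the typed decl only by refuting `H`. [folklore] -/
theorem line_decides_notH {S : Prop} (h : S → Theses.CardySusyWard.ParafermionPrecompact) :
    S → ¬ ParafermionBulkNondegenerate := fun hS => typed_iff_not_H.1 (h hS)

/-- Conversely `¬H` alone already proves the typed decl: no stub of a proof line carries content
beyond `¬H`. [folklore] -/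
theorem typed_of_notH (h : ¬ ParafermionBulkNondegenerate) :
    Theses.CardySusyWard.ParafermionPrecompact := typed_iff_not_H.2 h

/-! ## §2 Strengthen: every `S⁺ ⇒ typed` inherits falsity under `H` -/

/-- [folklore] -/
theorem strengthening_false_of_H {S : Prop} (h : S → Theses.CardySusyWard.ParafermionPrecompact)
    (hH : ParafermionBulkNondegenerate) : ¬ S := fun hS => line_decides_notH h hS hH

/-- The natural rigid strengthening `S⁺`: an a-priori bound at SOME exponent `t > 1/3` on the genuine
medial vertices of every compact, for every admissible family (edge-guarded, so it is not hit by the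
twin collapse). [folklore] -/
def BoundAboveThird : Prop :=
  ∀ (D : DobrushinDomain) (Λ : ℝ → DiscreteDobrushin), IsFamily D Λ →
    ∀ K : Set ℂ, IsCompact K → K ⊆ D.carrier →
      ∃ t : ℝ, (1:ℝ) / 3 < t ∧ ∃ C : ℝ, ∀ᶠ δ in 𝓝[>] (0:ℝ), ∀ z : MedialVertex,
        z ∈ (zdGraph 2).edgeSet → medialPoint δ z ∈ K → ‖F Λ δ z‖ ≤ C * δ ^ t

/-- `S⁺` gives vanishing at scale `δ^{1/3}` on the genuine vertices (a bound at `t` gives the bound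
clause at every `s ∈ (1/3, t)` … in fact directly: `C δ^t ≤ ε δ^{1/3}` eventually), and `F ≡ 0` off
the edge set, hence the typed decl. [folklore] -/
theorem typed_of_boundAboveThird (h : BoundAboveThird) :
    Theses.CardySusyWard.ParafermionPrecompact := by
  rw [parafermionPrecompact_iff_vanishing]
  intro D Λ hΛ K hK hKD ε hε
  obtain ⟨t, ht, C, hC⟩ := h D Λ hΛ K hK hKD
  -- a bound at exponent t > 1/3 gives the guarded bound clause at exponent 1/3 with constant ε
  have key := (clauses_of_bound_lt (Λ := Λ) (K := K) ht ⟨C, hC⟩).2 ε hε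
  obtain ⟨η, hη, hev⟩ := key
  have hsplit : ∀ δ : ℝ, 0 < δ → δ ^ t = δ ^ (t - 1 / 3) * δ ^ ((1:ℝ) / 3) := fun δ hδ => by
    rw [← Real.rpow_add hδ]; ring_nf
  have hsmall := eventually_const_mul_rpow_lt_one (|C| / ε) (sub_pos.2 ht)
  filter_upwards [hC, hsmall, self_mem_nhdsWithin] with δ hδ hlt (hpos : 0 < δ) z hzK
  by_cases hz : z ∈ (zdGraph 2).edgeSet
  · have hds : 0 < δ ^ ((1:ℝ) / 3) := Real.rpow_pos_of_pos hpos _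
    have h1 := hδ z hz hzK
    rw [hsplit δ hpos] at h1
    have h2 : C * (δ ^ (t - 1 / 3) * δ ^ ((1:ℝ) / 3)) ≤ |C| * δ ^ (t - 1 / 3) * δ ^ ((1:ℝ) / 3) := by
      rw [← mul_assoc]
      exact mul_le_mul_of_nonneg_right (mul_le_mul_of_nonneg_right (le_abs_self C)
        (Real.rpow_nonneg hpos.le _)) hds.le
    have h3 : |C| * δ ^ (t - 1 / 3) < ε := by
      have h' := mul_lt_mul_of_pos_right hlt hε
      rw [one_mul] at h'
      calc |C| * δ ^ (t - 1 / 3) = |C| / ε * δ ^ (t - 1 / 3) * ε := by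
            rw [div_mul_eq_mul_div, div_mul_cancel₀ _ hε.ne']
        _ < ε := h'
    calc ‖F Λ δ z‖ ≤ |C| * δ ^ (t - 1 / 3) * δ ^ ((1:ℝ) / 3) := h1.trans h2
      _ ≤ ε * δ ^ ((1:ℝ) / 3) := mul_le_mul_of_nonneg_right h3.le hds.le
  · rw [F_eq_zero_of_not_mem_edgeSet Λ δ hz, norm_zero]
    exact mul_nonneg hε.le (Real.rpow_nonneg hpos.le _)

/-- Hence the rigid strengthening is false under `H`: strengthening buys nothing but falsity. [folklore] -/
theorem boundAboveThird_false_of_H (hH : ParafermionBulkNondegenerate) : ¬ BoundAboveThird :=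
  strengthening_false_of_H typed_of_boundAboveThird hH

/-! ## §3 Decomposition: every split of a false statement has a false child -/

/-- For any two-piece split with a proved glue, the second piece is false under `H` given the first
(and symmetrically); the same one-liner covers `k = 3, 4` by currying. [folklore] -/
theorem split_child_false_of_H {S₁ S₂ : Prop}
    (hglue : S₁ → S₂ → Theses.CardySusyWard.ParafermionPrecompact)
    (hH : ParafermionBulkNondegenerate) (h₁ : S₁) : ¬ S₂ := fun h₂ =>
  typed_iff_not_H.1 (hglue h₁ h₂) hH

/-- The canonical (and only content-separating) split: typed `↔ C′ ∧ ¬H`, with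
`C′ = ∀ D Λ, ParafermionPrecompactRepairedAt D Λ` the intended, edge-guarded statement. [folklore] -/
theorem canonical_split :
    Theses.CardySusyWard.ParafermionPrecompact ↔
      (∀ (D : DobrushinDomain) (Λ : ℝ → DiscreteDobrushin), ParafermionPrecompactRepairedAt D Λ) ∧
        ¬ ParafermionBulkNondegenerate :=
  ⟨fun h => ⟨repaired_of_parafermionPrecompact h, typed_iff_not_H.1 h⟩, fun h => typed_iff_not_H.2 h.2⟩

/-- COSTUME certificate for the canonical split: its second child is equivalent to the parent, so
`route edit --split` is not available ("none the crux reworded"). [folklore] -/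
theorem child₂_iff_parent :
    (¬ ParafermionBulkNondegenerate) ↔ Theses.CardySusyWard.ParafermionPrecompact :=
  typed_iff_not_H.symm

/-- The first child is already reduced to crux stmt-CriticalPhenomena-11387 (landed p115329). [folklore] -/
theorem child₁_of_edgePrecompact (hEP : EdgePrecompact) :
    ∀ (D : DobrushinDomain) (Λ : ℝ → DiscreteDobrushin), ParafermionPrecompactRepairedAt D Λ :=
  FourClassVertexTransfer.repairedAt_of_edgePrecompact hEP

/-! ## §4 Negation: the exact bulk deliverable of a refutation line (pigeonhole localisation) -/

/-- **Localised mass.**  ONE Dobrushin domain, ONE admissible family, ONE compact `K ⊆ Ω`, constants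
`c, M > 0` and, frequently as `δ → 0⁺`, a finite set `S` of at most `M/δ` medial vertices with medial
points in `K` carrying total mass `Σ_{z ∈ S} ‖F_δ z‖ ≥ c · δ^{1/3 - 1}` (`= c δ^{-2/3}`, the DCS scale
of a cross-section sum).  This is what summing the vertex relations over a half-domain cut through `K`
(Duminil-Copin–Manolescu–Tassion 2021, proof of (6.19)) would give IF its boundary flux could be
(a) bounded below at the sharp exponent and (b) localised away from the marks. [folklore] -/
def LocalisedMass : Prop :=
  ∃ (D : DobrushinDomain) (Λ : ℝ → DiscreteDobrushin), IsFamily D Λ ∧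
    ∃ K : Set ℂ, IsCompact K ∧ K ⊆ D.carrier ∧ ∃ c : ℝ, 0 < c ∧ ∃ M : ℝ, 0 < M ∧
      ∃ᶠ δ in 𝓝[>] (0:ℝ), ∃ S : Finset MedialVertex,
        (∀ z ∈ S, medialPoint δ z ∈ K) ∧ (S.card : ℝ) ≤ M / δ ∧
          c * δ ^ ((1:ℝ) / 3 - 1) ≤ ∑ z ∈ S, ‖F Λ δ z‖

/-- **Pigeonhole.**  Localised mass ⇒ bulk non-degeneracy `H` (with `ε = c/(2M)`): some vertex of `S`
carries `‖F_δ z‖ > ε δ^{1/3}`. [folklore] -/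
theorem bulkNondegenerate_of_localisedMass (h : LocalisedMass) : ParafermionBulkNondegenerate := by
  obtain ⟨D, Λ, hΛ, K, hK, hKD, c, hc, M, hM, hfreq⟩ := h
  rw [parafermionBulkNondegenerate_iff_not_vanishing]
  intro hV
  have hε : 0 < c / (2 * M) := by positivity
  have hev := hV D Λ hΛ K hK hKD (c / (2 * M)) hε
  obtain ⟨δ, ⟨S, hSK, hcard, hmass⟩, hδ, (hpos : 0 < δ)⟩ :=
    (hfreq.and_eventually (hev.and self_mem_nhdsWithin)).exists
  have hds : 0 < δ ^ ((1:ℝ) / 3) := Real.rpow_pos_of_pos hpos _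
  have hsum : ∑ z ∈ S, ‖F Λ δ z‖ ≤ (S.card : ℝ) * (c / (2 * M) * δ ^ ((1:ℝ) / 3)) := by
    rw [← nsmul_eq_mul, ← Finset.sum_const]
    exact Finset.sum_le_sum fun z hz => hδ z (hSK z hz)
  have hsplit : δ ^ ((1:ℝ) / 3 - 1) = δ ^ ((1:ℝ) / 3) / δ := by
    rw [Real.rpow_sub hpos, Real.rpow_one]
  have hcard' : (S.card : ℝ) * (c / (2 * M) * δ ^ ((1:ℝ) / 3)) ≤ M / δ * (c / (2 * M) * δ ^ ((1:ℝ) / 3)) :=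
    mul_le_mul_of_nonneg_right hcard (by positivity)
  have hlt : M / δ * (c / (2 * M) * δ ^ ((1:ℝ) / 3)) < c * δ ^ ((1:ℝ) / 3 - 1) := by
    rw [hsplit]
    have : M / δ * (c / (2 * M) * δ ^ ((1:ℝ) / 3)) = (c / 2) * (δ ^ ((1:ℝ) / 3) / δ) := by
      field_simp
    rw [this]
    have hq : 0 < δ ^ ((1:ℝ) / 3) / δ := div_pos hds hpos
    nlinarith
  exact absurd (hmass.trans (hsum.trans hcard')) (not_le.2 hlt)

/-- Hence a refutation line = a proof of `LocalisedMass`; it refutes the typed decl. [folklore] -/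
theorem not_typed_of_localisedMass (h : LocalisedMass) :
    ¬ Theses.CardySusyWard.ParafermionPrecompact := fun hP =>
  typed_iff_not_H.1 hP (bulkNondegenerate_of_localisedMass h)

end Summit.CriticalPhenomena.CardyFormulaZ2.Cruxes.ParafermionPrecompact.StrategistCensus
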